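import Mathlib.Algebra.MvPolynomial.PDeriv
import Mathlib.RingTheory.MvPolynomial.Basic
import Mathlib.RingTheory.AlgebraicIndependent.Transcendental
import Mathlib.FieldTheory.IntermediateField.Adjoin.Defs
import Mathlib.Analysis.SpecialFunctions.Pow.Real
import Mathlib.Analysis.Complex.Basic
import Mathlib.Order.Filter.AtTopBot.Basic
import HarnessLib

/-!
# Roy's arithmetic criterion for Schanuel's conjecture

Topic: `Literature/NumberTheory/Transcendental`. Definition request `defn-RoyCriterion`
(route `Schanuel/RoyCriterion`).

## Content (Roy 2001, §1 — verified against the printed text)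

* `royD P = ∂P/∂X₀ + X₁ ∂P/∂X₁` — Roy's derivation `D` on `ℤ[X₀, X₁]` (Roy 2001, §1, display
  before Conjecture 2).
* `mvPolyHeight P` — the (naive) height: the maximum of the absolute values of the coefficients
  (Roy 2001, §1: "the height of a polynomial … is defined as the maximum of the absolute values of
  its coefficients").
* `RoyAdmissible s₀ s₁ t₀ t₁ u` — the parameter window (1) of Roy 2001:
  `s₀, s₁, t₀, t₁, u > 0`, `max{1, t₀, 2t₁} < min{s₀, 2s₁}`, `max{s₀, s₁ + t₁} < u < ½(1 + t₀ + t₁)`.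
* `RoyHypothesis y α s₀ s₁ t₀ t₁ u` — the hypothesis of Conjecture 2: **for any sufficiently large
  positive integer `N`** (verified: not "infinitely many") there is a non-zero `P_N ∈ ℤ[X₀, X₁]`
  with `deg_{X₀} P_N ≤ N^{t₀}`, `deg_{X₁} P_N ≤ N^{t₁}`, height `≤ e^N`, such that
  `|(D^k P_N)(∑ⱼ mⱼ yⱼ, ∏ⱼ αⱼ^{mⱼ})| ≤ exp(-N^u)` for all `k, m₁, …, m_l ∈ ℕ` with `k ≤ N^{s₀}` and
  `max mⱼ ≤ N^{s₁}`.
* `RoyCriterion l` — **Roy's Conjecture 2 for rank `l`**: for `y₁,…,y_l ∈ ℂ` linearly independent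
  over `ℚ`, `α₁,…,α_l ∈ ℂˣ` and every admissible parameter choice, `RoyHypothesis → tr.deg_ℚ
  ℚ(y, α) ≥ l` (Roy 2001, Conjecture 2).
* `SchanuelRank l` — Schanuel's conjecture for rank `l` (Roy 2001, Conjecture 1), in the format of
  `Literature.Periods.SchanuelConjecture` (`Summits/Schanuel/Statement.lean` is `∀ l, SchanuelRank l`,
  see `schanuelConjecture_iff` there — stated here as `Iff.rfl`-shaped remark in the docstring
  only, since `Literature` may not import `Problems`).
* Named fact `Roy2001_iff : ∀ l, RoyCriterion l ↔ SchanuelRank l` (Roy 2001, §1: "if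
  [Conjecture 2] is true for some positive integer `l` and some choice of parameters … then
  Schanuel's conjecture is true for this value of `l`. Conversely, … if Conjecture 1 is true for
  some positive integer `l`, then Conjecture 2 is also true for the same value of `l` and for any
  choice of parameters satisfying (1)"; the reverse implication rests on Thm. 1).

## Source

* D. Roy, *An arithmetic criterion for the values of the exponential function*, Acta Arith. 97
  (2001), 183–194: §1, Conjectures 1–2, (1), Theorem 1.

## Design choices

* `α : Fin l → ℂ` with the side condition `∀ j, α j ≠ 0` (rather than `ℂˣ`), so that
  `Set.range α ⊆ ℂ` feeds `IntermediateField.adjoin` directly.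
* "For any sufficiently large `N`" is `∀ᶠ N in atTop`; real powers `N^{t}` are `Real.rpow`.
* Evaluation of `P ∈ ℤ[X₀,X₁]` at the complex point `(∑ mⱼyⱼ, ∏ αⱼ^{mⱼ})` is `MvPolynomial.aeval`.
* Roy's remark that Conjecture 2 for *one* admissible parameter choice already implies Schanuel
  for that `l` means the `∀`-over-parameters form chosen here is equivalent to the `∃` form; the
  `∀` form is the literal reading of "let `s₀, …, u` be positive numbers satisfying (1)".
-/

noncomputable section

open MvPolynomial Filter Complex

namespace Literature.NumberTheory.Transcendental

/-- Roy's derivation `D = ∂/∂X₀ + X₁ ∂/∂X₁` on `ℤ[X₀, X₁]` (Roy 2001, §1).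
[cite: Roy2001, §1 (the derivation D)] -/
def royD (P : MvPolynomial (Fin 2) ℤ) : MvPolynomial (Fin 2) ℤ :=
  pderiv 0 P + X 1 * pderiv 1 P

/-- The naive height of an integer polynomial: the maximum of the absolute values of its
coefficients (`0` for the zero polynomial) (Roy 2001, §1). [cite: Roy2001, §1 (height)] -/
def mvPolyHeight {σ : Type*} (P : MvPolynomial σ ℤ) : ℕ :=
  P.support.sup fun m => (P.coeff m).natAbs

/-- Roy's parameter window (1): `s₀, s₁, t₀, t₁, u > 0`, `max{1, t₀, 2t₁} < min{s₀, 2s₁}` and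
`max{s₀, s₁ + t₁} < u < ½ (1 + t₀ + t₁)` (Roy 2001, (1)). [cite: Roy2001, §1 (1)] -/
def RoyAdmissible (s₀ s₁ t₀ t₁ u : ℝ) : Prop :=
  0 < s₀ ∧ 0 < s₁ ∧ 0 < t₀ ∧ 0 < t₁ ∧ 0 < u ∧
    max 1 (max t₀ (2 * t₁)) < min s₀ (2 * s₁) ∧
    max s₀ (s₁ + t₁) < u ∧ u < (1 + t₀ + t₁) / 2

/-- The hypothesis of Roy's Conjecture 2 for the data `(y, α)` and parameters `(s₀, s₁, t₀, t₁, u)`: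
for every sufficiently large positive integer `N` there is a non-zero `P_N ∈ ℤ[X₀, X₁]` of
partial degrees `≤ N^{t₀}` in `X₀`, `≤ N^{t₁}` in `X₁`, of height `≤ e^N`, with
`|(D^k P_N)(∑ⱼ mⱼ yⱼ, ∏ⱼ αⱼ^{mⱼ})| ≤ exp(-N^u)` for all `k, mⱼ ∈ ℕ` with `k ≤ N^{s₀}`,
`max mⱼ ≤ N^{s₁}` (Roy 2001, Conjecture 2). [cite: Roy2001, Conjecture 2] -/
def RoyHypothesis {l : ℕ} (y α : Fin l → ℂ) (s₀ s₁ t₀ t₁ u : ℝ) : Prop :=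
  ∀ᶠ N : ℕ in atTop, ∃ P : MvPolynomial (Fin 2) ℤ, P ≠ 0 ∧
    (P.degreeOf 0 : ℝ) ≤ (N : ℝ) ^ t₀ ∧ (P.degreeOf 1 : ℝ) ≤ (N : ℝ) ^ t₁ ∧
    (mvPolyHeight P : ℝ) ≤ Real.exp N ∧
    ∀ (k : ℕ) (m : Fin l → ℕ), (k : ℝ) ≤ (N : ℝ) ^ s₀ → (∀ j, (m j : ℝ) ≤ (N : ℝ) ^ s₁) →
      ‖aeval ![∑ j, (m j : ℂ) * y j, ∏ j, α j ^ m j] (royD^[k] P)‖ ≤ Real.exp (-(N : ℝ) ^ u)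

/-- **Roy's criterion (Conjecture 2 of Roy 2001) for rank `l`**: for `y₁, …, y_l ∈ ℂ` linearly
independent over `ℚ`, `α₁, …, α_l ∈ ℂˣ` and positive parameters in the window (1), the
hypothesis `RoyHypothesis` implies `tr.deg_ℚ ℚ(y₁,…,y_l, α₁,…,α_l) ≥ l`. Equivalent, for each
`l`, to Schanuel's conjecture for rank `l` (`Roy2001_iff`). [cite: Roy2001, Conjecture 2] -/
def RoyCriterion (l : ℕ) : Prop :=
  ∀ (y α : Fin l → ℂ), LinearIndependent ℚ y → (∀ j, α j ≠ 0) →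
    ∀ (s₀ s₁ t₀ t₁ u : ℝ), RoyAdmissible s₀ s₁ t₀ t₁ u → RoyHypothesis y α s₀ s₁ t₀ t₁ u →
      (l : Cardinal) ≤ Algebra.trdeg ℚ
        ↥(IntermediateField.adjoin ℚ (Set.range y ∪ Set.range α))

/-- **Schanuel's conjecture for rank `l`** (Roy 2001, Conjecture 1): if `y₁, …, y_l ∈ ℂ` are
linearly independent over `ℚ` then `tr.deg_ℚ ℚ(y₁,…,y_l, e^{y₁},…,e^{y_l}) ≥ l`. Same format as
`Literature.Periods.SchanuelConjecture = ∀ l, SchanuelRank l`. [cite: Roy2001, Conjecture 1] -/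
def SchanuelRank (l : ℕ) : Prop :=
  ∀ (y : Fin l → ℂ), LinearIndependent ℚ y →
    (l : Cardinal) ≤ Algebra.trdeg ℚ
      ↥(IntermediateField.adjoin ℚ (Set.range y ∪ Set.range (cexp ∘ y)))

/-- NAMED FACT (Roy 2001, §1 with Theorem 1): for every `l ≥ 1`, Roy's Conjecture 2 for rank
`l` is equivalent to Schanuel's conjecture for rank `l` (`←`: Waldschmidt's auxiliary-function
construction; `→`: Roy's interpolation Theorem 2 via Theorem 1). Roy states it for positive `l`;
for `l = 0` both sides hold trivially. Users take `(h : Roy2001_iff)`.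
[cite: Roy2001, §1 (equivalence of Conjectures 1 and 2 for each l) and Thm. 1] -/
def Roy2001_iff : Prop :=
  ∀ l : ℕ, RoyCriterion l ↔ SchanuelRank l

/-! ### API -/

/-- `D` is additive. [cite: Roy2001, §1] -/
@[simp] theorem royD_add (P Q : MvPolynomial (Fin 2) ℤ) : royD (P + Q) = royD P + royD Q := by
  simp [royD, map_add, mul_add]
  ring

/-- `D 0 = 0`. [cite: Roy2001, §1] -/
@[simp] theorem royD_zero : royD 0 = 0 := by simp [royD]

/-- `D X₀ = 1`. [cite: Roy2001, §1] -/
@[simp] theorem royD_X_zero : royD (X 0) = 1 := by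
  simp [royD, pderiv_X]

/-- `D X₁ = X₁` (so `D` is the derivation with `X₁` an "exponential"). [cite: Roy2001, §1] -/
@[simp] theorem royD_X_one : royD (X 1) = X 1 := by
  simp [royD, pderiv_X]

/-- Leibniz rule for `D` (it is a derivation, being a `ℤ[X₀,X₁]`-combination of `∂₀, ∂₁`).
[cite: Roy2001, §1] -/
theorem royD_mul (P Q : MvPolynomial (Fin 2) ℤ) : royD (P * Q) = royD P * Q + P * royD Q := by
  simp only [royD, Derivation.leibniz, smul_eq_mul]
  ring

/-- The height of the zero polynomial is `0`. [cite: Roy2001, §1] -/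
@[simp] theorem mvPolyHeight_zero {σ : Type*} : mvPolyHeight (0 : MvPolynomial σ ℤ) = 0 := by
  simp [mvPolyHeight]

/-- Every coefficient is bounded by the height. [cite: Roy2001, §1] -/
theorem natAbs_coeff_le_mvPolyHeight {σ : Type*} (P : MvPolynomial σ ℤ) (m : σ →₀ ℕ) :
    (P.coeff m).natAbs ≤ mvPolyHeight P := by
  by_cases hm : m ∈ P.support
  · exact Finset.le_sup (f := fun m => (P.coeff m).natAbs) hm
  · simp [MvPolynomial.notMem_support_iff.1 hm]

/-- Admissible parameters exist, e.g. `(s₀, s₁, t₀, t₁, u) = (1.3, 0.7, 1.2, 0.5, 1.32)`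
(so `RoyCriterion l` is not vacuous in its parameter quantifier). [cite: Roy2001, §1 (1)] -/
theorem royAdmissible_example : RoyAdmissible 1.3 0.7 1.2 0.5 1.32 := by
  refine ⟨by norm_num, by norm_num, by norm_num, by norm_num, by norm_num, ?_, ?_, by norm_num⟩ <;>
    norm_num

/-- Schanuel for rank `0` holds trivially. [folklore] -/
theorem schanuelRank_zero : SchanuelRank 0 := by
  intro y _
  simp

/-- Roy's criterion for rank `0` holds trivially. [folklore] -/
theorem royCriterion_zero : RoyCriterion 0 := by
  intro y α _ _ s₀ s₁ t₀ t₁ u _ _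
  simp

end Literature.NumberTheory.Transcendental

end
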